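import Mathlib
import Literature.Analysis.FluidPDE.WholeSpaceIBP

set_option linter.dupNamespace false

/-!
# The Landau flux identity (stub `landauTail_flux_identity`, crux stmt-NavierStokesRegularity-1944)

Support theorem for the line `registered` of the crux `LandauTail.LandauTailBlowup`: a steady
Navier–Stokes flow `(U, P)` on `ℝ³ ∖ {0}`, smooth off the origin with `U (c x) = c⁻¹ U x`, carries a
point momentum flux: for every smooth compactly supported solenoidal `φ`,
`∫ ⟪U, (U·∇)φ⟫ + ⟪U, Δφ⟫ = -⟪φ 0, B⟫`, `B = ∫ ⟪U, ∇Ψ₁⟫ U + P ∇Ψ₁ + (ΔΨ₁) U`, `Ψ₁(y) =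
smoothTransition (‖y‖² - 1)` (Landau 1944; Batchelor §4.6; Šverák, arXiv:math/0604550 §2 (2.3);
Lemarié-Rieusset 2016 (10.48)). Proof: test against `Ψ₁ • φ(δ ·)` (whole-space integration by
parts after smoothing `(U, P)` in the unit ball), rescale `x = δ z` on the left, let `δ → 0⁺`.
-/

namespace Summit.NavierStokesRegularity.NavierStokesRegularity.Theorems

open MeasureTheory Metric Set Filter Topology InnerProductSpace Literature.Analysis.FluidPDE
open scoped RealInnerProductSpace Laplacian

/-- Local notation for physical space `ℝ³`. -/
local notation "E3" => EuclideanSpace ℝ (Fin 3)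

/-- **Leibniz rule for the Laplacian of a scalar multiple** of a field:
`Δ(θ w) = (Δθ) w + 2 Dw(∇θ) + θ Δw` for `C²` data. [folklore] -/
theorem landauTail_laplacian_smul {θ : E3 → ℝ} {w : E3 → E3} (hθ : ContDiff ℝ 2 θ)
    (hw : ContDiff ℝ 2 w) (x : E3) :
    (Δ fun y => θ y • w y) x =
      (Δ θ) x • w x + (2 : ℝ) • fderiv ℝ w x (gradient θ x) + θ x • (Δ w) x := by
  set b := stdOrthonormalBasis ℝ E3
  have hθ1 : Differentiable ℝ θ := hθ.differentiable two_ne_zero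
  have hw1 : Differentiable ℝ w := hw.differentiable two_ne_zero
  have hdθ : ∀ i, Differentiable ℝ fun y => fderiv ℝ θ y (b i) := fun i =>
    ((hθ.fderiv_right (m := 1) le_rfl).clm_apply contDiff_const).differentiable one_ne_zero
  have hdw : ∀ i, Differentiable ℝ fun y => fderiv ℝ w y (b i) := fun i =>
    ((hw.fderiv_right (m := 1) le_rfl).clm_apply contDiff_const).differentiable one_ne_zero
  have h1 : ∀ i y, fderiv ℝ (fun y => θ y • w y) y (b i) =
      θ y • fderiv ℝ w y (b i) + fderiv ℝ θ y (b i) • w y := fun i y => by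
    rw [fderiv_fun_smul (hθ1 y) (hw1 y)]; rfl
  have h2 : ∀ i, fderiv ℝ (fun y => θ y • fderiv ℝ w y (b i) + fderiv ℝ θ y (b i) • w y) x (b i) =
      θ x • fderiv ℝ (fun y => fderiv ℝ w y (b i)) x (b i)
        + (2 : ℝ) • (fderiv ℝ θ x (b i) • fderiv ℝ w x (b i))
        + fderiv ℝ (fun y => fderiv ℝ θ y (b i)) x (b i) • w x := fun i => by
    rw [fderiv_fun_add ((hθ1 x).fun_smul (hdw i x)) ((hdθ i x).fun_smul (hw1 x)),
      fderiv_fun_smul (hθ1 x) (hdw i x), fderiv_fun_smul (hdθ i x) (hw1 x)]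
    simp only [_root_.add_apply, _root_.FunLike.coe_smul, Pi.smul_apply,
      ContinuousLinearMap.smulRight_apply, two_smul]
    abel
  have h3 : ∑ i, fderiv ℝ θ x (b i) • fderiv ℝ w x (b i) = fderiv ℝ w x (gradient θ x) := by
    have : ∀ i, fderiv ℝ θ x (b i) = ⟪b i, gradient θ x⟫ := fun i => by
      rw [real_inner_comm, gradient, InnerProductSpace.toDual_symm_apply]
    simp_rw [this, ← map_smul, ← map_sum, b.sum_repr']
  rw [laplacian_eq_sum_fderiv_fderiv b (hθ.fun_smul hw), laplacian_eq_sum_fderiv_fderiv b hθ,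
    laplacian_eq_sum_fderiv_fderiv b hw]
  simp_rw [h1, h2, Finset.sum_add_distrib, ← Finset.smul_sum, ← Finset.sum_smul, h3]
  abel

/-- **Scaling of the Laplacian**: `Δ(φ(c ·))(z) = c² (Δφ)(c z)` for a `C²` field. [folklore] -/
theorem landauTail_laplacian_comp_smul {φ : E3 → E3} (hφ : ContDiff ℝ 2 φ) (c : ℝ) (z : E3) :
    (Δ fun y => φ (c • y)) z = c ^ 2 • (Δ φ) (c • z) := by
  set L : E3 →L[ℝ] E3 := c • ContinuousLinearMap.id ℝ E3 with hL
  have h := L.iteratedFDeriv_comp_right hφ z (i := 2) le_rfl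
  have hc : (fun y => φ (c • y)) = φ ∘ ⇑L := rfl
  rw [congrFun (laplacian_eq_iteratedFDeriv_stdOrthonormalBasis _) z,
    congrFun (laplacian_eq_iteratedFDeriv_stdOrthonormalBasis _) (c • z)]
  simp only [Finset.smul_sum]
  refine Finset.sum_congr rfl fun i _ => ?_
  rw [hc, h, ContinuousMultilinearMap.compContinuousLinearMap_apply]
  have e : (fun j : Fin 2 => L (![stdOrthonormalBasis ℝ E3 i, stdOrthonormalBasis ℝ E3 i] j)) =
      fun j => c • ![stdOrthonormalBasis ℝ E3 i, stdOrthonormalBasis ℝ E3 i] j := rfl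
  rw [e, ContinuousMultilinearMap.map_smul_univ, Fin.prod_const, hL]
  rfl

/-- The derivatives of the cutoff `Ψ₁(y) = smoothTransition (‖y‖² - 1)` vanish where it is locally
constant: inside the unit ball and outside the ball of radius `√2`. [folklore] -/
theorem landauTail_fderiv_laplacian_cutoff_eq_zero {z : E3} (hz : ‖z‖ ^ 2 < 1 ∨ 2 < ‖z‖ ^ 2) :
    fderiv ℝ (fun y : E3 => Real.smoothTransition (‖y‖ ^ 2 - 1)) z = 0 ∧
      (Δ fun y : E3 => Real.smoothTransition (‖y‖ ^ 2 - 1)) z = 0 := by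
  obtain ⟨c, hc⟩ : ∃ c : ℝ,
      (fun y : E3 => Real.smoothTransition (‖y‖ ^ 2 - 1)) =ᶠ[𝓝 z] fun _ => c := by
    rcases hz with hz | hz
    · refine ⟨0, eventuallyEq_of_mem ((isOpen_lt (by fun_prop) (by fun_prop)).mem_nhds hz :
        {y : E3 | ‖y‖ ^ 2 < 1} ∈ 𝓝 z) fun y hy => Real.smoothTransition.zero_of_nonpos ?_⟩
      simp only [mem_setOf_eq] at hy; linarith
    · refine ⟨1, eventuallyEq_of_mem ((isOpen_lt (by fun_prop) (by fun_prop)).mem_nhds hz :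
        {y : E3 | 2 < ‖y‖ ^ 2} ∈ 𝓝 z) fun y hy => Real.smoothTransition.one_of_one_le ?_⟩
      simp only [mem_setOf_eq] at hy; linarith
  refine ⟨by rw [hc.fderiv_eq]; simp, ?_⟩
  rw [(laplacian_congr_nhds hc).eq_of_nhds,
    congrFun (laplacian_eq_iteratedFDeriv_stdOrthonormalBasis _) z]
  simp [iteratedFDeriv_const_of_ne]

/-- A field which is `C^∞` off the origin, multiplied by the inner cutoff
`smoothTransition (4‖x‖² - 1)` (vanishing on `‖x‖ ≤ 1/2`), is globally smooth. [folklore] -/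
theorem landauTail_contDiff_cutoff_smul {F : Type*} [NormedAddCommGroup F] [NormedSpace ℝ F]
    {f : E3 → F} {n : ℕ∞} (hf : ContDiffOn ℝ (⊤ : ℕ∞) f {0}ᶜ) :
    ContDiff ℝ n fun x => Real.smoothTransition (4 * ‖x‖ ^ 2 - 1) • f x := by
  refine contDiff_iff_contDiffAt.2 fun x => ?_
  by_cases hx : x = 0
  · subst hx
    refine (contDiffAt_const (c := (0 : F))).congr_of_eventuallyEq ?_
    filter_upwards [((isOpen_lt (by fun_prop) (by fun_prop)).mem_nhds (by simp [mem_setOf_eq]) :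
      {y : E3 | ‖y‖ ^ 2 < 1 / 4} ∈ 𝓝 (0 : E3))] with y hy
    rw [Real.smoothTransition.zero_of_nonpos (by linarith [show ‖y‖ ^ 2 < 1 / 4 from hy]),
      zero_smul]
  · exact (Real.smoothTransition.contDiff.comp ((contDiff_const.mul (contDiff_norm_sq ℝ)).sub
      contDiff_const)).contDiffAt.smul
        ((hf.contDiffAt (isOpen_compl_singleton.mem_nhds hx)).of_le (by exact_mod_cast le_top))

/-- A continuous function vanishing with a compactly supported `Φ`, `DΦ`, `ΔΦ` is integrable.
[folklore] -/
theorem landauTail_integrable_of_vanish {f : E3 → ℝ} {Φ : E3 → E3} (hf : Continuous f)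
    (hΦc : HasCompactSupport Φ) (h : ∀ x, Φ x = 0 → fderiv ℝ Φ x = 0 → (Δ Φ) x = 0 → f x = 0) :
    Integrable f :=
  hf.integrable_of_hasCompactSupport (HasCompactSupport.intro hΦc fun x hx =>
    h x (image_eq_zero_of_notMem_tsupport hx) (fderiv_of_notMem_tsupport ℝ hx)
      (laplacian_eq_zero_of_notMem_tsupport hx))

/-- **Very weak form for smooth fields**: if `(V·∇)V + ∇Q = ΔV`, `div V = 0` hold on the support
of `Φ ∈ C_c²` then `∫ ⟪V, (V·∇)Φ⟫ + ⟪V, ΔΦ⟫ = -∫ Q div Φ` (Leray 1934 §6). [folklore] -/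
theorem landauTail_veryWeak_smooth {V Φ : E3 → E3} {Q : E3 → ℝ} (hV : ContDiff ℝ 2 V)
    (hQ : ContDiff ℝ 1 Q) (hΦ : ContDiff ℝ 2 Φ) (hΦc : HasCompactSupport Φ)
    (hns : ∀ x, Φ x ≠ 0 → convect V V x + gradient Q x = (1 : ℝ) • (Δ V) x)
    (hdiv : ∀ x, Φ x ≠ 0 → VectorCalculus.divergence V x = 0) :
    ∫ x, (⟪V x, convect V Φ x⟫ + ⟪V x, (Δ Φ) x⟫) = -∫ x, Q x * VectorCalculus.divergence Φ x := by
  set b := stdOrthonormalBasis ℝ E3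
  obtain ⟨hV1, hΦ1⟩ : ContDiff ℝ 1 V ∧ ContDiff ℝ 1 Φ := ⟨hV.of_le one_le_two, hΦ.of_le one_le_two⟩
  have h1 := integral_inner_convect_add_eq_zero hV1 hV1 hΦ1 hΦc
  have h2 := integral_inner_gradient_eq_neg_integral_mul_divergence hQ hΦ1 hΦc
  have h3 := integral_inner_laplacian_add_eq_zero b hV hΦ1 (Or.inr hΦc)
  have h4 := integral_inner_laplacian_add_eq_zero b hΦ hV1 (Or.inl hΦc)
  have h5 : ∫ x, VectorCalculus.divergence V x * ⟪V x, Φ x⟫ = 0 :=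
    integral_eq_zero_of_ae (ae_of_all _ fun x => by
      by_cases hx : Φ x = 0 <;> [simp [hx]; simp [hdiv x hx]])
  have h6 : ∫ x, (⟪convect V V x, Φ x⟫ + ⟪gradient Q x, Φ x⟫ - ⟪(Δ V) x, Φ x⟫) = 0 :=
    integral_eq_zero_of_ae (ae_of_all _ fun x => by
      by_cases hx : Φ x = 0 <;>
        [simp [hx]; simp only [Pi.zero_apply, ← inner_add_left, hns x hx, one_smul, sub_self]])
  simp only [real_inner_comm (fderiv ℝ V _ _) (fderiv ℝ Φ _ _), real_inner_comm (V _) ((Δ Φ) _)]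
    at h4
  obtain ⟨hcV, hcΦ, hcgQ, hcΔV, hcΔΦ⟩ : Continuous V ∧ Continuous Φ ∧ Continuous (gradient Q) ∧
      Continuous (Δ V) ∧ Continuous (Δ Φ) := ⟨hV.continuous, hΦ.continuous,
    continuous_gradient_of_contDiff hQ, continuous_laplacian hV, continuous_laplacian hΦ⟩
  obtain ⟨hcdV, hcdΦ⟩ : Continuous (fderiv ℝ V) ∧ Continuous (fderiv ℝ Φ) :=
    ⟨hV.continuous_fderiv (by norm_num), hΦ.continuous_fderiv (by norm_num)⟩
  have iA : Integrable fun x => ⟪convect V V x, Φ x⟫ := landauTail_integrable_of_vanish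
    (by simp only [convect_apply]; fun_prop) hΦc fun x h0 _ _ => by simp [h0]
  have iB : Integrable fun x => ⟪gradient Q x, Φ x⟫ :=
    landauTail_integrable_of_vanish (by fun_prop) hΦc fun x h0 _ _ => by simp [h0]
  have iC : Integrable fun x => ⟪(Δ V) x, Φ x⟫ :=
    landauTail_integrable_of_vanish (by fun_prop) hΦc fun x h0 _ _ => by simp [h0]
  have iD : Integrable fun x => ⟪V x, convect V Φ x⟫ := landauTail_integrable_of_vanish
    (by simp only [convect_apply]; fun_prop) hΦc fun x _ h1 _ => by simp [h1]
  have iE : Integrable fun x => ⟪V x, (Δ Φ) x⟫ :=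
    landauTail_integrable_of_vanish (by fun_prop) hΦc fun x _ _ h2 => by simp [h2]
  have iAB : Integrable fun x => ⟪convect V V x, Φ x⟫ + ⟪gradient Q x, Φ x⟫ := iA.add iB
  rw [integral_sub iAB iC, integral_add iA iB] at h6
  rw [integral_add iD iE]; linarith

/-- **Localized very weak identity**: if the steady equations for smooth `(V, Q)` hold where the
cutoff `χ ≠ 0`, then testing against `χ • φ` (`φ` solenoidal) and expanding the Leibniz rules gives
`∫ χ (⟪V,(V·∇)φ⟫ + ⟪V,Δφ⟫) = -∫ (Dχ(V)⟪V,φ⟫ + Q⟪φ,∇χ⟫ + Δχ⟪V,φ⟫ + 2⟪V, Dφ(∇χ)⟫)`. [folklore] -/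
theorem landauTail_localized {V φ : E3 → E3} {Q χ : E3 → ℝ} (hV : ContDiff ℝ 2 V)
    (hQ : ContDiff ℝ 1 Q) (hχ : ContDiff ℝ 2 χ) (hφ : ContDiff ℝ 2 φ) (hφc : HasCompactSupport φ)
    (hφdiv : ∀ x, VectorCalculus.divergence φ x = 0)
    (hns : ∀ x, χ x ≠ 0 → convect V V x + gradient Q x = (1 : ℝ) • (Δ V) x)
    (hdiv : ∀ x, χ x ≠ 0 → VectorCalculus.divergence V x = 0) :
    ∫ x, χ x * (⟪V x, convect V φ x⟫ + ⟪V x, (Δ φ) x⟫) =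
      -∫ x, (fderiv ℝ χ x (V x) * ⟪V x, φ x⟫ + Q x * ⟪φ x, gradient χ x⟫
        + (Δ χ) x * ⟪V x, φ x⟫ + 2 * ⟪V x, fderiv ℝ φ x (gradient χ x)⟫) := by
  have hd : ∀ x, DifferentiableAt ℝ χ x ∧ DifferentiableAt ℝ φ x := fun x =>
    ⟨hχ.differentiable two_ne_zero x, hφ.differentiable two_ne_zero x⟩
  have key := landauTail_veryWeak_smooth hV hQ (hχ.fun_smul hφ) (hφc.smul_left (f := χ))
    (fun x hx => hns x (smul_ne_zero_iff.1 hx).1) (fun x hx => hdiv x (smul_ne_zero_iff.1 hx).1)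
  have e3 : ∀ x, VectorCalculus.divergence (fun y => χ y • φ y) x = ⟪φ x, gradient χ x⟫ :=
    fun x => by rw [divergence_smul_apply (hd x).1 (hd x).2, hφdiv, mul_zero, zero_add]
  obtain ⟨hcV, hcQ, hcφ, hcχ, hcΔφ, hcΔχ⟩ : Continuous V ∧ Continuous Q ∧ Continuous φ ∧
      Continuous χ ∧ Continuous (Δ φ) ∧ Continuous (Δ χ) := ⟨hV.continuous, hQ.continuous,
    hφ.continuous, hχ.continuous, continuous_laplacian hφ, continuous_laplacian hχ⟩
  obtain ⟨hcdφ, hcdχ, hcgχ⟩ : Continuous (fderiv ℝ φ) ∧ Continuous (fderiv ℝ χ) ∧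
      Continuous (gradient χ) := ⟨hφ.continuous_fderiv (by norm_num),
    hχ.continuous_fderiv (by norm_num), continuous_gradient_of_contDiff (hχ.of_le one_le_two)⟩
  have i1 : Integrable fun x => χ x * (⟪V x, convect V φ x⟫ + ⟪V x, (Δ φ) x⟫) :=
    landauTail_integrable_of_vanish (by simp only [convect_apply]; fun_prop) hφc
      fun x _ h1 h2 => by simp [h1, h2]
  have i2 : Integrable fun x => fderiv ℝ χ x (V x) * ⟪V x, φ x⟫ + (Δ χ) x * ⟪V x, φ x⟫
      + 2 * ⟪V x, fderiv ℝ φ x (gradient χ x)⟫ :=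
    landauTail_integrable_of_vanish (by fun_prop) hφc fun x h0 h1 _ => by simp [h0, h1]
  have i3 : Integrable fun x => Q x * ⟪φ x, gradient χ x⟫ :=
    landauTail_integrable_of_vanish (by fun_prop) hφc fun x h0 _ _ => by simp [h0]
  have hl : ∫ x, (⟪V x, convect V (fun y => χ y • φ y) x⟫ + ⟪V x, (Δ fun y => χ y • φ y) x⟫) =
      ∫ x, (χ x * (⟪V x, convect V φ x⟫ + ⟪V x, (Δ φ) x⟫) + (fderiv ℝ χ x (V x) * ⟪V x, φ x⟫
        + (Δ χ) x * ⟪V x, φ x⟫ + 2 * ⟪V x, fderiv ℝ φ x (gradient χ x)⟫)) :=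
    integral_congr_ae (ae_of_all _ fun x => by
      beta_reduce
      rw [convect_smul_apply (hd x).1 (hd x).2, landauTail_laplacian_smul hχ hφ]
      simp only [inner_add_right, real_inner_smul_right, convect_apply]
      ring)
  have hr : ∫ x, Q x * VectorCalculus.divergence (fun y => χ y • φ y) x =
      ∫ x, Q x * ⟪φ x, gradient χ x⟫ :=
    integral_congr_ae (ae_of_all _ fun x => by beta_reduce; rw [e3])
  have hs : ∫ x, (fderiv ℝ χ x (V x) * ⟪V x, φ x⟫ + Q x * ⟪φ x, gradient χ x⟫
      + (Δ χ) x * ⟪V x, φ x⟫ + 2 * ⟪V x, fderiv ℝ φ x (gradient χ x)⟫) =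
      (∫ x, (fderiv ℝ χ x (V x) * ⟪V x, φ x⟫ + (Δ χ) x * ⟪V x, φ x⟫
        + 2 * ⟪V x, fderiv ℝ φ x (gradient χ x)⟫)) + ∫ x, Q x * ⟪φ x, gradient χ x⟫ := by
    rw [← integral_add i2 i3]
    exact integral_congr_ae (ae_of_all _ fun x => by ring)
  rw [hl, integral_add i1 i2, hr] at key
  rw [hs]
  linarith
set_option maxHeartbeats 400000 in -- buildfix (bf3-g27): 160k/180k FAIL, 200k PASS at accept time; line-neutral budget line
/-- **Integrability of the very weak integrand**: for `U` continuous off `0` and homogeneous of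
degree `-1` (`|U x| ≤ M/‖x‖`) and `φ ∈ C_c²`, `⟪U, (U·∇)φ⟫ + ⟪U, Δφ⟫ = O(‖x‖⁻²)` is integrable on
`ℝ³`. [folklore] -/
theorem landauTail_integrable_veryWeak {U φ : E3 → E3} (hUc : ContinuousOn U {0}ᶜ)
    (hUhom : ∀ c : ℝ, 0 < c → ∀ x, U (c • x) = c⁻¹ • U x) (hφ : ContDiff ℝ 2 φ)
    (hφc : HasCompactSupport φ) : Integrable fun x => ⟪U x, convect U φ x⟫ + ⟪U x, (Δ φ) x⟫ := by
  obtain ⟨M, hM⟩ : ∃ M, ∀ x, x ≠ 0 → ‖U x‖ ≤ M * ‖x‖ ^ (-1 : ℝ) := by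
    obtain ⟨M, hM⟩ := (isCompact_sphere (0 : E3) 1).exists_bound_of_continuousOn
      (hUc.mono fun x hx h0 => by simp [show x = 0 from h0] at hx)
    refine ⟨M, fun x hx => ?_⟩
    have hn : 0 < ‖x‖ := norm_pos_iff.2 hx
    have h1 : U x = ‖x‖⁻¹ • U (‖x‖⁻¹ • x) := by
      rw [hUhom _ (inv_pos.2 hn), inv_inv, smul_smul, inv_mul_cancel₀ hn.ne', one_smul]
    rw [h1, norm_smul, norm_inv, norm_norm, Real.rpow_neg_one, mul_comm]
    exact mul_le_mul_of_nonneg_right (hM _ (by simp [norm_smul, hn.ne'])) (inv_nonneg.2 hn.le)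
  obtain ⟨R, hR⟩ : ∃ R, tsupport φ ⊆ ball (0 : E3) R := hφc.isCompact.isBounded.subset_ball 0
  obtain ⟨A, hA⟩ := (hφ.continuous_fderiv (by norm_num)).bounded_above_of_compact_support
    (hφc.fderiv (𝕜 := ℝ))
  obtain ⟨B, hB⟩ := (continuous_laplacian hφ).bounded_above_of_compact_support
    (HasCompactSupport.intro hφc fun x hx => laplacian_eq_zero_of_notMem_tsupport hx)
  have hsupp : Function.support (fun x => ⟪U x, convect U φ x⟫ + ⟪U x, (Δ φ) x⟫) ⊆ ball 0 R := by
    refine fun x hx => hR (not_notMem.1 fun h => hx ?_)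
    simp [fderiv_of_notMem_tsupport ℝ h, laplacian_eq_zero_of_notMem_tsupport h]
  rw [← integrableOn_iff_integrable_of_support_subset hsupp]
  have hm1 : ContinuousOn (fun x => ⟪U x, convect U φ x⟫) {0}ᶜ :=
    hUc.inner (((hφ.continuous_fderiv (by norm_num)).continuousOn).clm_apply hUc)
  have hm2 : ContinuousOn (fun x => ⟪U x, (Δ φ) x⟫) {0}ᶜ :=
    hUc.inner (continuous_laplacian hφ).continuousOn
  refine IntegrableOn.add ?_ ?_
  · refine integrableOn_ball_of_norm_le_rpow (by simp) (C := M * M * A) (α := 2)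
      (by rw [finrank_euclideanSpace_fin]; norm_num) (ae_restrict_of_ae ?_)
      (measurable_of_continuousOn_compl_singleton 0 hm1).aestronglyMeasurable
    filter_upwards [Measure.ae_ne volume (0 : E3)] with x hx
    have hx' : 0 < ‖x‖ := norm_pos_iff.2 hx
    have hU0 : 0 ≤ M * ‖x‖ ^ (-1 : ℝ) := (norm_nonneg _).trans (hM x hx)
    calc ‖⟪U x, convect U φ x⟫‖ ≤ ‖U x‖ * ‖convect U φ x‖ := norm_inner_le_norm _ _
      _ ≤ (M * ‖x‖ ^ (-1 : ℝ)) * (A * (M * ‖x‖ ^ (-1 : ℝ))) := by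
        refine mul_le_mul (hM x hx) ((ContinuousLinearMap.le_opNorm _ _).trans ?_)
          (norm_nonneg _) hU0
        exact mul_le_mul (hA x) (hM x hx) (norm_nonneg _) ((norm_nonneg _).trans (hA x))
      _ = M * M * A * ‖x‖ ^ (-(2 : ℝ)) := by
        rw [show (-(2 : ℝ)) = -1 + -1 by norm_num, Real.rpow_add hx']; ring
  · refine integrableOn_ball_of_norm_le_rpow (by simp) (C := M * B) (α := 1)
      (by rw [finrank_euclideanSpace_fin]; norm_num) (ae_restrict_of_ae ?_)
      (measurable_of_continuousOn_compl_singleton 0 hm2).aestronglyMeasurable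
    filter_upwards [Measure.ae_ne volume (0 : E3)] with x hx
    calc ‖⟪U x, (Δ φ) x⟫‖ ≤ ‖U x‖ * ‖(Δ φ) x‖ := norm_inner_le_norm _ _
      _ ≤ (M * ‖x‖ ^ (-1 : ℝ)) * B :=
        mul_le_mul (hM x hx) (hB x) (norm_nonneg _) ((norm_nonneg _).trans (hM x hx))
      _ = M * B * ‖x‖ ^ (-(1 : ℝ)) := by ring

/-- **Rescaling** (`U` homogeneous of degree `-1`, `Ut = U` where `χ ≠ 0`, `δ > 0`, `x = δ z`):
`∫ χ(z) (⟪Ut,(Ut·∇)φ(δ ·)⟫ + ⟪Ut, Δ(φ(δ ·))⟫) dz = ∫ χ(x/δ) (⟪U,(U·∇)φ⟫ + ⟪U,Δφ⟫) dx`. [folklore] -/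
theorem landauTail_changeVars {U Ut φ : E3 → E3} {χ : E3 → ℝ} (hφ : ContDiff ℝ 2 φ)
    (hUhom : ∀ c : ℝ, 0 < c → ∀ x, U (c • x) = c⁻¹ • U x) (hUt : ∀ x, χ x ≠ 0 → Ut x = U x)
    {δ : ℝ} (hδ : 0 < δ) :
    ∫ z, χ z * (⟪Ut z, convect Ut (fun y => φ (δ • y)) z⟫ + ⟪Ut z, (Δ fun y => φ (δ • y)) z⟫) =
      ∫ x, χ (δ⁻¹ • x) * (⟪U x, convect U φ x⟫ + ⟪U x, (Δ φ) x⟫) := by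
  set g : E3 → ℝ := fun z =>
    χ z * (⟪Ut z, convect Ut (fun y => φ (δ • y)) z⟫ + ⟪Ut z, (Δ fun y => φ (δ • y)) z⟫) with hg
  have h1 : ∫ x, g (δ⁻¹ • x) = δ ^ 3 • ∫ z, g z := by
    have := Measure.integral_comp_inv_smul_of_nonneg volume g hδ.le
    rwa [finrank_euclideanSpace_fin] at this
  have h2 : ∀ x, g (δ⁻¹ • x) = δ ^ 3 * (χ (δ⁻¹ • x) * (⟪U x, convect U φ x⟫ + ⟪U x, (Δ φ) x⟫)) := by
    intro x
    simp only [hg, convect_apply]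
    by_cases hx : χ (δ⁻¹ • x) = 0
    · simp [hx]
    have hx' : δ • δ⁻¹ • x = x := by rw [smul_smul, mul_inv_cancel₀ hδ.ne', one_smul]
    rw [hUt _ hx, hUhom _ (inv_pos.2 hδ), inv_inv, fderiv_comp_smul (f := φ) δ,
      landauTail_laplacian_comp_smul hφ, hx']
    simp only [_root_.FunLike.coe_smul, Pi.smul_apply, map_smul, real_inner_smul_left,
      real_inner_smul_right]
    ring
  rw [integral_congr_ae (ae_of_all _ h2), integral_const_mul, smul_eq_mul] at h1
  exact (mul_left_cancel₀ (pow_ne_zero 3 hδ.ne') h1).symm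

/-- **The Landau flux identity** (Landau 1944; Batchelor §4.6; Šverák 2011 §2 (2.3);
Lemarié-Rieusset 2016 (10.48)): for a `(-1)`-homogeneous steady Navier–Stokes flow `(U, P)` smooth
off the origin and a smooth compactly supported solenoidal `φ`, `∫ ⟪U,(U·∇)φ⟫ + ⟪U,Δφ⟫ = -⟪φ 0, B⟫`,
`B = ∫ ⟪U,∇Ψ₁⟫ U + P ∇Ψ₁ + (ΔΨ₁) U`, `Ψ₁(y) = smoothTransition (‖y‖² - 1)`. [folklore] -/
theorem landauTail_flux_identity : ∀ (U : EuclideanSpace ℝ (Fin 3) → EuclideanSpace ℝ (Fin 3)) (P : EuclideanSpace ℝ (Fin 3) → ℝ) (φ : EuclideanSpace ℝ (Fin 3) → EuclideanSpace ℝ (Fin 3)), ContDiffOn ℝ (⊤ : ℕ∞) U {0}ᶜ → ContDiffOn ℝ (⊤ : ℕ∞) P {0}ᶜ → (∀ x : EuclideanSpace ℝ (Fin 3), x ≠ 0 → Literature.Analysis.FluidPDE.convect U U x + gradient P x = (1 : ℝ) • Laplacian.laplacian U x) → (∀ x : EuclideanSpace ℝ (Fin 3), x ≠ 0 → Literature.Analysis.FluidPDE.VectorCalculus.divergence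 U x = 0) → (∀ c : ℝ, 0 < c → ∀ x : EuclideanSpace ℝ (Fin 3), U (c • x) = c⁻¹ • U x) → (∀ c : ℝ, 0 < c → ∀ x : EuclideanSpace ℝ (Fin 3), P (c • x) = (c ^ 2)⁻¹ * P x) → ContDiff ℝ (⊤ : ℕ∞) φ → HasCompactSupport φ → (∀ x, Literature.Analysis.FluidPDE.VectorCalculus.divergence φ x = 0) → ∫ x, (inner ℝ (U x) (Literature.Analysis.FluidPDE.convect U φ x) + inner ℝ (U x) (Laplacian.laplacian φ x)) = - inner ℝ (φ 0) (∫ z, (inner ℝ (U z) (gradient (fun y : EuclideanSpace ℝ (Fin 3) => Real.smoothTransition (‖y‖ ^ 2 - 1)) z) • U z + P z • gradient (fun y : EuclideanSpace ℝ (Fin 3) => Real.smoothTransition (‖y‖ ^ 2 - 1)) z + Laplacian.laplacian (fun y : EuclideanSpace ℝ (Fin 3) => Real.smoothTransition (‖y‖ ^ 2 - 1)) z • U z)) := by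
  intro U P φ hU hP hns hdiv hUhom _ hφ hφc hφdiv
  set χ : E3 → ℝ := fun y => Real.smoothTransition (‖y‖ ^ 2 - 1) with hχ
  have hφ2 : ContDiff ℝ 2 φ := contDiff_infty.1 hφ 2
  have hχ2 : ContDiff ℝ 2 χ :=
    Real.smoothTransition.contDiff.comp ((contDiff_norm_sq ℝ).sub contDiff_const)
  have hχ0 : ∀ x, χ x ≠ 0 → 1 < ‖x‖ ^ 2 := fun x hx =>
    not_le.1 fun h => hx (Real.smoothTransition.zero_of_nonpos (by linarith))
  set Ut : E3 → E3 := fun x => Real.smoothTransition (4 * ‖x‖ ^ 2 - 1) • U x with hUt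
  set Pt : E3 → ℝ := fun x => Real.smoothTransition (4 * ‖x‖ ^ 2 - 1) • P x with hPt
  have hUts : ContDiff ℝ 2 Ut := landauTail_contDiff_cutoff_smul hU
  have hPts : ContDiff ℝ 1 Pt := landauTail_contDiff_cutoff_smul hP
  have hnear : ∀ x : E3, 1 / 2 < ‖x‖ ^ 2 → Ut =ᶠ[𝓝 x] U ∧ Pt =ᶠ[𝓝 x] P := fun x hx => by
    have hS : {y : E3 | 1 / 2 < ‖y‖ ^ 2} ∈ 𝓝 x :=
      (isOpen_lt (by fun_prop) (by fun_prop)).mem_nhds hx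
    have h1 : ∀ y ∈ {y : E3 | 1 / 2 < ‖y‖ ^ 2}, Real.smoothTransition (4 * ‖y‖ ^ 2 - 1) = 1 :=
      fun y hy => Real.smoothTransition.one_of_one_le (by simp only [mem_setOf_eq] at hy; linarith)
    exact ⟨eventuallyEq_of_mem hS fun y hy => by simp [hUt, h1 y hy],
      eventuallyEq_of_mem hS fun y hy => by simp [hPt, h1 y hy]⟩
  have hloc : ∀ x, χ x ≠ 0 → (convect Ut Ut x + gradient Pt x = (1 : ℝ) • (Δ Ut) x) ∧
      VectorCalculus.divergence Ut x = 0 := fun x hx => by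
    have h1 := hχ0 x hx
    have hx0 : x ≠ 0 := by rintro rfl; norm_num at h1
    obtain ⟨hu, hp⟩ := hnear x (by linarith)
    rw [convect_apply, VectorCalculus.divergence, hu.fderiv_eq, hu.eq_of_nhds, hp.gradient_eq,
      (laplacian_congr_nhds hu).eq_of_nhds]
    exact ⟨hns x hx0, hdiv x hx0⟩
  set F : E3 → ℝ := fun x => ⟪U x, convect U φ x⟫ + ⟪U x, (Δ φ) x⟫ with hF
  set R : ℝ → E3 → ℝ := fun δ z => fderiv ℝ χ z (Ut z) * ⟪Ut z, φ (δ • z)⟫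
      + Pt z * ⟪φ (δ • z), gradient χ z⟫ + (Δ χ) z * ⟪Ut z, φ (δ • z)⟫
      + 2 * ⟪Ut z, δ • fderiv ℝ φ (δ • z) (gradient χ z)⟫ with hR
  have hL : ∀ δ : ℝ, 0 < δ → ∫ x, χ (δ⁻¹ • x) * F x = -∫ z, R δ z := fun δ hδ => by
    have hφδ : ContDiff ℝ 2 fun y => φ (δ • y) := hφ2.comp (contDiff_const_smul δ)
    have hφδdiv : ∀ x, VectorCalculus.divergence (fun y => φ (δ • y)) x = 0 := fun x => by
      have := hφdiv (δ • x)
      simp only [VectorCalculus.divergence, fderiv_comp_smul (f := φ) δ,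
        ContinuousLinearMap.toLinearMap_smul, map_smul, smul_eq_zero] at this ⊢
      exact Or.inr this
    simp only [hF, hR]
    rw [← landauTail_changeVars hφ2 hUhom
      (fun x h => (hnear x (by linarith [hχ0 x h])).1.eq_of_nhds) hδ, landauTail_localized hUts hPts
      hχ2 hφδ (hφc.comp_smul hδ.ne') hφδdiv (fun x hx => (hloc x hx).1) fun x hx => (hloc x hx).2]
    congr 1
    refine integral_congr_ae (ae_of_all _ fun z => ?_)
    beta_reduce
    rw [fderiv_comp_smul (f := φ) δ]
    rfl
  obtain ⟨hcUt, hcPt, hcφ, hcχ, hcΔχ⟩ : Continuous Ut ∧ Continuous Pt ∧ Continuous φ ∧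
      Continuous χ ∧ Continuous (Δ χ) := ⟨hUts.continuous, hPts.continuous, hφ.continuous,
    hχ2.continuous, continuous_laplacian hχ2⟩
  obtain ⟨hcdχ, hcgχ, hcdφ⟩ : Continuous (fderiv ℝ χ) ∧ Continuous (gradient χ) ∧
      Continuous (fderiv ℝ φ) := ⟨hχ2.continuous_fderiv (by norm_num),
    continuous_gradient_of_contDiff (hχ2.of_le one_le_two), hφ2.continuous_fderiv (by norm_num)⟩
  -- the limit `δ → 0⁺`: dominated convergence on the left, a continuous parametric integral right
  have hFi : Integrable F := landauTail_integrable_veryWeak hU.continuousOn hUhom hφ2 hφc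
  have hlim1 : Tendsto (fun δ : ℝ => ∫ x, χ (δ⁻¹ • x) * F x) (𝓝[>] 0) (𝓝 (∫ x, F x)) := by
    refine tendsto_integral_filter_of_dominated_convergence (fun x => ‖F x‖)
      (Eventually.of_forall fun δ => (by fun_prop : Continuous fun x => χ (δ⁻¹ • x))
        |>.aestronglyMeasurable.mul hFi.aestronglyMeasurable)
      (Eventually.of_forall fun δ => ae_of_all _ fun x => ?_) hFi.norm ?_
    · rw [norm_mul, Real.norm_of_nonneg (Real.smoothTransition.nonneg _)]
      exact mul_le_of_le_one_left (norm_nonneg _) (Real.smoothTransition.le_one _)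
    · filter_upwards [Measure.ae_ne volume (0 : E3)] with x hx
      refine tendsto_const_nhds.congr' ?_
      filter_upwards [Ioo_mem_nhdsGT (half_pos (norm_pos_iff.2 hx))] with δ hδ
      have h2 : 2 < ‖δ⁻¹ • x‖ := by
        rw [norm_smul, norm_inv, Real.norm_of_nonneg hδ.1.le, lt_inv_mul_iff₀ hδ.1]
        linarith [hδ.2]
      rw [show χ (δ⁻¹ • x) = 1 from Real.smoothTransition.one_of_one_le (by nlinarith), one_mul]
  have hout : ∀ z, z ∉ closedBall (0 : E3) 2 → (∀ δ, R δ z = 0) ∧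
      ⟪Ut z, gradient χ z⟫ • Ut z + Pt z • gradient χ z + (Δ χ) z • Ut z = 0 := fun z hz => by
    obtain ⟨h1, h2⟩ : fderiv ℝ χ z = 0 ∧ (Δ χ) z = 0 := landauTail_fderiv_laplacian_cutoff_eq_zero
      (Or.inr (by rw [mem_closedBall_zero_iff, not_le] at hz; nlinarith))
    simp [hR, h1, h2, gradient]
  have hlim2 : Tendsto (fun δ => ∫ z, R δ z) (𝓝[>] 0) (𝓝 (∫ z, R 0 z)) := by
    have hc := continuous_parametric_integral_of_continuous (μ := volume)
      (by simp only [hR, Function.uncurry_def]; fun_prop : Continuous (Function.uncurry R))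
      (isCompact_closedBall (0 : E3) 2)
    have heq : ∀ δ, ∫ z in closedBall (0 : E3) 2, R δ z = ∫ z, R δ z := fun δ =>
      setIntegral_eq_integral_of_forall_compl_eq_zero fun z hz => (hout z hz).1 δ
    simp_rw [heq] at hc
    exact (hc.tendsto 0).mono_left nhdsWithin_le_nhds
  have hmain : ∫ x, F x = -∫ z, R 0 z := tendsto_nhds_unique hlim1
    (hlim2.neg.congr' (by filter_upwards [self_mem_nhdsWithin] with δ hδ using (hL δ hδ).symm))
  have hg : ∀ z v, ⟪v, gradient χ z⟫ = fderiv ℝ χ z v := fun z v => by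
    rw [real_inner_comm, gradient, InnerProductSpace.toDual_symm_apply]
  have hB : ∀ z, R 0 z = ⟪φ 0, ⟪U z, gradient χ z⟫ • U z + P z • gradient χ z + (Δ χ) z • U z⟫ ∧
      ⟪Ut z, gradient χ z⟫ • Ut z + Pt z • gradient χ z + (Δ χ) z • Ut z =
        ⟪U z, gradient χ z⟫ • U z + P z • gradient χ z + (Δ χ) z • U z := fun z => by
    by_cases hz : 1 / 2 < ‖z‖ ^ 2
    · obtain ⟨hu, hp⟩ := hnear z hz
      refine ⟨?_, by simp only [hu.eq_of_nhds, hp.eq_of_nhds]⟩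
      simp only [hR, hu.eq_of_nhds, hp.eq_of_nhds, zero_smul, zero_mul, mul_zero, add_zero,
        inner_add_right, real_inner_smul_right, hg, real_inner_comm (φ 0)]
    · obtain ⟨h1, h2⟩ : fderiv ℝ χ z = 0 ∧ (Δ χ) z = 0 :=
        landauTail_fderiv_laplacian_cutoff_eq_zero (Or.inl (by linarith [not_lt.1 hz]))
      simp [hR, h1, h2, gradient]
  have hBi : Integrable fun z => ⟪U z, gradient χ z⟫ • U z + P z • gradient χ z + (Δ χ) z • U z :=
    ((by fun_prop : Continuous fun z => ⟪Ut z, gradient χ z⟫ • Ut z + Pt z • gradient χ z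
      + (Δ χ) z • Ut z).integrable_of_hasCompactSupport (HasCompactSupport.intro
        (isCompact_closedBall (0 : E3) 2) fun z hz => (hout z hz).2)).congr
      (ae_of_all _ fun z => (hB z).2)
  rw [hmain, integral_congr_ae (ae_of_all _ fun z => (hB z).1), integral_inner hBi]

end Summit.NavierStokesRegularity.NavierStokesRegularity.Theorems
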